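import Summits.PneNP.PneNP.Theses.PlantedClique

/-!
# Route PlantedClique — `PlantedcliqueDetectionGlue` (stmt-PneNP-10556)

Weak-detection hardness at every admissible clique-size sequence (`PlantedcliqueIndistinguishable`, BBH18 Conj. 2.1 form)
gives strong-detection hardness at `k_ε n = ⌈n^{1/2−ε}⌉₊` for every `ε > 0` (`PlantedcliqueDetectionHard`).
`k_ε` is admissible with `ε' = min(ε/2, 1/4)` (`⌈n^{1/2−ε}⌉₊ ≤ n^{1/2−ε} + 1 ≤ n^{1/2−ε'}` eventually), and with `η = 1/2`
the error sum is eventually `≥ 1/2`, so it cannot tend to `0`.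
-/

set_option linter.dupNamespace false -- `Summit.PneNP.PneNP.…`: summit = sub-problem name (D-0017 single-conjunct layout)

namespace Summit.PneNP.PneNP.Theorems

open Filter Topology
open Literature.Probability.RandomGraphs.PlantedClique

/-- **Support item `PlantedcliqueDetectionGlue` of route PlantedClique (stmt-PneNP-10556)**:
`PlantedcliqueIndistinguishable → PlantedcliqueDetectionHard` — the sequence `⌈n^{1/2−ε}⌉₊` is admissible
(exponent `1/2 − min(ε/2, 1/4)`), and an error sum eventually `≥ 1/2` does not tend to `0`.
[cite: BrennanBreslerHuleihel2018, §2 (Conj. 2.1)] [cite: BarakHopkinsKelnerKothariMoitraPotechin2019, §1 Rem. 2] -/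
theorem plantedClique_detectionGlue_proof : Summit.PneNP.PneNP.Theses.PlantedClique.PlantedcliqueDetectionGlue := by
  unfold Summit.PneNP.PneNP.Theses.PlantedClique.PlantedcliqueDetectionGlue
    Summit.PneNP.PneNP.Theses.PlantedClique.PlantedcliqueIndistinguishable
    Summit.PneNP.PneNP.Theses.PlantedClique.PlantedcliqueDetectionHard
  intro hInd ε hε
  unfold Literature.Probability.RandomGraphs.PlantedClique.PlantedCliqueDetectionHard
  intro T hT hlim
  set k : ℕ → ℕ := fun n => ⌈(n : ℝ) ^ (1 / 2 - ε)⌉₊ with hk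
  -- admissibility of `k`
  have hadm : ∃ ε' : ℝ, 0 < ε' ∧ ∀ᶠ n : ℕ in atTop, (k n : ℝ) ≤ (n : ℝ) ^ (1 / 2 - ε') := by
    refine ⟨min (ε / 2) (1 / 4), lt_min (by linarith) (by norm_num), ?_⟩
    set ε' : ℝ := min (ε / 2) (1 / 4) with hε'
    have hε'ε : ε' < ε := lt_of_le_of_lt (min_le_left _ _) (by linarith)
    have hε'q : ε' ≤ 1 / 4 := min_le_right _ _
    have h1 : Tendsto (fun n : ℕ => (n : ℝ) ^ (ε' - ε)) atTop (𝓝 0) := by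
      have hcomp := (tendsto_rpow_neg_atTop (y := ε - ε') (by linarith)).comp tendsto_natCast_atTop_atTop
      have heq : (fun n : ℕ => (n : ℝ) ^ (ε' - ε)) = (fun x : ℝ => x ^ (-(ε - ε'))) ∘ (Nat.cast : ℕ → ℝ) := by
        ext n
        simp [neg_sub]
      rw [heq]
      exact hcomp
    have h2 : Tendsto (fun n : ℕ => (n : ℝ) ^ (1 / 2 - ε')) atTop atTop :=
      (tendsto_rpow_atTop (by linarith)).comp tendsto_natCast_atTop_atTop
    have e1 : ∀ᶠ n : ℕ in atTop, (n : ℝ) ^ (ε' - ε) ≤ 1 / 2 := h1.eventually (ge_mem_nhds (by norm_num))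
    have e2 : ∀ᶠ n : ℕ in atTop, (2 : ℝ) ≤ (n : ℝ) ^ (1 / 2 - ε') := h2.eventually (eventually_ge_atTop 2)
    have e3 : ∀ᶠ n : ℕ in atTop, 1 ≤ n := eventually_ge_atTop 1
    filter_upwards [e1, e2, e3] with n hn1 hn2 hn3
    have hnpos : (0 : ℝ) < n := by exact_mod_cast hn3
    have hA : 0 ≤ (n : ℝ) ^ (1 / 2 - ε') := Real.rpow_nonneg hnpos.le _
    have hy : (n : ℝ) ^ (1 / 2 - ε) = (n : ℝ) ^ (1 / 2 - ε') * (n : ℝ) ^ (ε' - ε) := by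
      rw [← Real.rpow_add hnpos]
      congr 1
      ring
    have hy0 : 0 ≤ (n : ℝ) ^ (1 / 2 - ε) := Real.rpow_nonneg hnpos.le _
    have hmul : (n : ℝ) ^ (1 / 2 - ε') * (n : ℝ) ^ (ε' - ε) ≤ (n : ℝ) ^ (1 / 2 - ε') * (1 / 2) :=
      mul_le_mul_of_nonneg_left hn1 hA
    calc (k n : ℝ) = (⌈(n : ℝ) ^ (1 / 2 - ε)⌉₊ : ℝ) := rfl
      _ ≤ (n : ℝ) ^ (1 / 2 - ε) + 1 := (Nat.ceil_lt_add_one hy0).le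
      _ = (n : ℝ) ^ (1 / 2 - ε') * (n : ℝ) ^ (ε' - ε) + 1 := by rw [hy]
      _ ≤ (n : ℝ) ^ (1 / 2 - ε') * (1 / 2) + (n : ℝ) ^ (1 / 2 - ε') * (1 / 2) := by linarith
      _ = (n : ℝ) ^ (1 / 2 - ε') := by ring
  have hev := hInd k hadm T hT (1 / 2) (by norm_num)
  have hsmall : ∀ᶠ n : ℕ in atTop, typeIError T n + typeIIError T k n < 1 / 2 :=
    hlim.eventually (gt_mem_nhds (by norm_num))
  obtain ⟨n, hn1, hn2⟩ := (hev.and hsmall).exists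
  linarith

end Summit.PneNP.PneNP.Theorems
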